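import Mathlib
import Summits.MatrixMultiplication.MatrixMultiplication.Theorems.AbelianSTPPSieveVP
import Summits.MatrixMultiplication.MatrixMultiplication.Theorems.AbelianSTPPCensusVPHereditary

/-!
# Completion-budget bounds for the vP certificate — the core inequalities (REF [73] for U11-G; the U11-P analogue, planner gen 7)

The depth-first certificate for crux `ShapeExclusionVP337` (stub `stub_vp_208_337` especially) is feasible only with the
completion-budget bound of REF [73] (kit j248982: bound OFF costs ×30 at order 150, ×165 at 175).  Its mathematical core is a
one-line consequence of the rule at ONE admissible `t` exceeding every middle size; this file proves the two cores in the
tree's vocabulary (`pAB pBC pCA ubB lB U11GFormB U11PFormB` of `AbelianSTPPSieveVP`), for the checker to combine with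
additivity of `U = P_AB + P_BC + P_CA` and `SV = Σ aᵢbᵢcᵢ` over appended blocks:

* `u11G_budget_core` — if form B of U11-G holds for the list, `P_CA ≤ M`, `3 ≤ t ≤ min(P_AB, P_BC)`, `t ≤ L_B(t)` and every
  `bᵢ < t`, then `t·U + 1 ≤ 2t² + t·M + SV`  (REF [73] CLAIM (*): `t·U − SV ≤ 2t² − 1 + tM`);
* `u11P_budget_core` — if form B of U11-P holds (prime order `p`), `P_CA ≤ p`, `1 ≤ t ≤ min(P_AB, P_BC)`, every `bᵢ < t` and
  some `aᵢcᵢ ≥ 1`, then `t·U ≤ t² + t·p + SV`  (the Pollard branch `P_AB + P_BC − t ≥ p` is impossible: it would force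
  `t·P_CA ≤ SV ≤ (t−1)·P_CA`).
Cell mm-stpp, planner gen 7, 2026-08-26 (HOME/mm-stpp-plan/calc/w2-g7/PBOUND.md; HOME/mm-stpp-ref/rederive/GBOUND-REDERIVE-g14.md §1).
WHAT THIS IS NOT: not the checker, not the additivity bookkeeping, no census verdict, no ω statement.
-/

-- single-conjunct summit: the mandated namespace repeats `MatrixMultiplication`.
set_option linter.dupNamespace false

namespace Summit.MatrixMultiplication.MatrixMultiplication.Theorems

namespace VPBudget

open Finset

variable {N : ℕ}

/-- With every middle size below `t`, the head of the ceiling `UB_B(t)` is `SV = Σ aᵢbᵢcᵢ`. -/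
theorem ubB_eq_of_lt (M : ℕ) (a b c : Fin N → ℕ) (t : ℕ) (hb : ∀ i, b i < t) :
    ubB M a b c t = (∑ i, a i * b i * c i) + t * (M - pCA a b c) := by
  unfold ubB
  congr 1
  refine sum_congr rfl fun i _ => ?_
  rw [min_eq_right (hb i).le]
  ring

/-- `SV ≤ (t − 1) · P_CA` when every middle size is below `t`. -/
theorem sv_le_of_lt (a b c : Fin N → ℕ) (t : ℕ) (hb : ∀ i, b i < t) :
    (∑ i, a i * b i * c i) ≤ (t - 1) * pCA a b c := by
  unfold pCA
  rw [mul_sum]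
  refine sum_le_sum fun i _ => ?_
  have : b i ≤ t - 1 := Nat.le_sub_one_of_lt (hb i)
  calc a i * b i * c i = b i * (c i * a i) := by ring
    _ ≤ (t - 1) * (c i * a i) := Nat.mul_le_mul_right _ this

/-- **U11-G budget core** (REF [73] CLAIM (*)): `t·U + 1 ≤ 2t² + t·M + SV`. -/
theorem u11G_budget_core {M : ℕ} {a b c : Fin N → ℕ} (hG : U11GFormB M a b c) (hCA : pCA a b c ≤ M)
    {t : ℕ} (h3 : 3 ≤ t) (hab : t ≤ pAB a b c) (hbc : t ≤ pBC a b c) (hl : t ≤ lB a b c t) (hb : ∀ i, b i < t) :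
    t * (pAB a b c + pBC a b c + pCA a b c) + 1 ≤ 2 * t ^ 2 + t * M + ∑ i, a i * b i * c i := by
  have h := (hG t (by omega) hab hbc hl).2 h3
  rw [ubB_eq_of_lt M a b c t hb] at h
  have hsub : t * (M - pCA a b c) = t * M - t * pCA a b c := mul_tsub t M (pCA a b c)
  have hle : t * pCA a b c ≤ t * M := Nat.mul_le_mul_left t hCA
  have hdist : t * (pAB a b c + pBC a b c + pCA a b c) = t * (pAB a b c + pBC a b c) + t * pCA a b c := by ring
  omega

/-- **U11-P budget core** (planner gen 7): at a prime order `p`, `t·U ≤ t² + t·p + SV`. -/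
theorem u11P_budget_core {p : ℕ} {a b c : Fin N → ℕ} (hP : U11PFormB p a b c) (hCA : pCA a b c ≤ p)
    (hpos : 1 ≤ pCA a b c) {t : ℕ} (h1 : 1 ≤ t) (hab : t ≤ pAB a b c) (hbc : t ≤ pBC a b c) (hb : ∀ i, b i < t) :
    t * (pAB a b c + pBC a b c + pCA a b c) ≤ t ^ 2 + t * p + ∑ i, a i * b i * c i := by
  have h := hP t h1 hab hbc
  rw [ubB_eq_of_lt p a b c t hb] at h
  have hsv := sv_le_of_lt a b c t hb
  have hle : t * pCA a b c ≤ t * p := Nat.mul_le_mul_left t hCA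
  have hsub : t * (p - pCA a b c) = t * p - t * pCA a b c := mul_tsub t p (pCA a b c)
  have hsv' : (∑ i, a i * b i * c i) + pCA a b c ≤ t * pCA a b c := by
    have hm : (t - 1) * pCA a b c + pCA a b c = t * pCA a b c := by
      obtain ⟨s, rfl⟩ := Nat.exists_eq_add_of_le h1
      simp [Nat.add_mul, Nat.add_comm]
    omega
  have hdist : t * (pAB a b c + pBC a b c + pCA a b c) = t * (pAB a b c + pBC a b c) + t * pCA a b c := by ring
  have hsub2 : t * (pAB a b c + pBC a b c - t) = t * (pAB a b c + pBC a b c) - t * t := mul_tsub t _ t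
  have htt : t * t ≤ t * (pAB a b c + pBC a b c) := Nat.mul_le_mul_left t (by omega)
  have hsq : t ^ 2 = t * t := sq t
  -- the Pollard branch `p ≤ P_AB + P_BC − t` is impossible (it forces `t·P_CA ≤ SV ≤ (t−1)·P_CA` with `P_CA ≥ 1`)
  rcases Nat.lt_or_ge (pAB a b c + pBC a b c - t) p with hbr | hbr
  · rw [min_eq_right hbr.le] at h
    omega
  · rw [min_eq_left hbr] at h
    omega

/-! ### Prefix (DFS-node) forms: the conditions are checked on a sub-list `G = F ∘ φ`, the conclusion is about `F`

In the depth-first search the current node is a sub-list `G` of the (unknown) completed list `F`; `t ≤ P_AB(G)`, `t ≤ P_BC(G)`,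
`t ≤ L_B(G,t)` are monotone in the list (`VPRules.pAB_comp_le`, `lB_comp_le`, p416879), so checking them on `G` suffices;
`bᵢ < t` for the members still to be added is guaranteed by the search order (every later member has all sizes ≤ the current
threshold), which the checker supplies as the hypothesis `hb`. -/

/-- U11-G budget bound, prefix form: hypotheses on the sub-list `F ∘ φ`, conclusion on `F`. -/
theorem u11G_budget_prefix {K : ℕ} (φ : Fin K ↪ Fin N) {M : ℕ} {a b c : Fin N → ℕ} (hG : U11GFormB M a b c)
    (hCA : pCA a b c ≤ M) {t : ℕ} (h3 : 3 ≤ t) (hab : t ≤ pAB (a ∘ φ) (b ∘ φ) (c ∘ φ))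
    (hbc : t ≤ pBC (a ∘ φ) (b ∘ φ) (c ∘ φ)) (hl : t ≤ lB (a ∘ φ) (b ∘ φ) (c ∘ φ) t) (hb : ∀ i, b i < t) :
    t * (pAB a b c + pBC a b c + pCA a b c) + 1 ≤ 2 * t ^ 2 + t * M + ∑ i, a i * b i * c i :=
  u11G_budget_core hG hCA h3 (hab.trans (VPRules.pAB_comp_le φ a b c)) (hbc.trans (VPRules.pBC_comp_le φ a b c))
    (hl.trans (VPRules.lB_comp_le φ a b c t)) hb

/-- U11-P budget bound, prefix form (prime order `p`): hypotheses on the sub-list `F ∘ φ` (with `K ≥ 1` members of positive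
sizes, so that `P_CA(F) ≥ P_CA(G) ≥ 1`), conclusion on `F`. -/
theorem u11P_budget_prefix {K : ℕ} (φ : Fin K ↪ Fin N) {p : ℕ} {a b c : Fin N → ℕ} (hP : U11PFormB p a b c)
    (hCA : pCA a b c ≤ p) (hpos : 1 ≤ pCA (a ∘ φ) (b ∘ φ) (c ∘ φ)) {t : ℕ} (h1 : 1 ≤ t)
    (hab : t ≤ pAB (a ∘ φ) (b ∘ φ) (c ∘ φ)) (hbc : t ≤ pBC (a ∘ φ) (b ∘ φ) (c ∘ φ)) (hb : ∀ i, b i < t) :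
    t * (pAB a b c + pBC a b c + pCA a b c) ≤ t ^ 2 + t * p + ∑ i, a i * b i * c i :=
  u11P_budget_core hP hCA (hpos.trans (VPRules.pCA_comp_le φ a b c)) h1 (hab.trans (VPRules.pAB_comp_le φ a b c))
    (hbc.trans (VPRules.pBC_comp_le φ a b c)) hb

/-- The budget identity behind the checker's bookkeeping: `U` and `SV` split over a sub-list and its complement, so
`t·U(F) − SV(F) = (t·U(G) − SV(G)) + Σ_{added j} (t·U_j − V_j)`; here as the two additive splittings. -/
theorem sv_eq_sv_comp_add {K : ℕ} (φ : Fin K ↪ Fin N) (a b c : Fin N → ℕ) :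
    (∑ i, a i * b i * c i) = (∑ k, a (φ k) * b (φ k) * c (φ k)) +
      ∑ i ∈ (Finset.univ : Finset (Fin N)) \ Finset.univ.map φ, a i * b i * c i :=
  VPRules.sum_eq_sum_comp_add φ (fun i => a i * b i * c i)

end VPBudget

end Summit.MatrixMultiplication.MatrixMultiplication.Theorems
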